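import Mathlib.RingTheory.Localization.Away.Basic
import Mathlib.RingTheory.Localization.Ideal
import Mathlib.Algebra.MonoidAlgebra.MapDomain
import Literature.AlgebraicGeometry.Resolution.WeightedResolutionDatum
import Literature.AlgebraicGeometry.Resolution.CobordantBlowupFiltration

/-!
# Extended Rees algebras localise (crux `WeightedConstruction`, stub 1b)

Route `ResolutionOfSingularities/WeightedInvariant`, crux `WeightedConstruction`
(stmt-ResolutionOfSingularities-0571), line `support-first-weights-second`, stub
`stub_extReesAlgebra_localization`.

For a sequence of ideals `I : ℕ → Ideal A`, the datum file's extended Rees algebra is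
`extReesAlgebra I = A[t⁻¹, a tⁿ : n ≥ 1, a ∈ Iₙ] ⊆ A[t, t⁻¹]` (an `Algebra.adjoin`). If
`A' = A[1/h]` is the localisation away from `h` and `I'ₙ = Iₙ A'` for all `n` (the sections of a
quasi-coherent ideal sheaf over a basic open `D(h)`), then the base change of Laurent polynomials
`A[t, t⁻¹] → A'[t, t⁻¹]` restricts to a ring map `ψ : A[t⁻¹, Iₙ tⁿ] → A'[t⁻¹, I'ₙ tⁿ]`, and along
`ψ` the target is the localisation of the source away from `h`: `Γ(B(D(h))) = Γ(B(U))[1/h]`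
(quasi-coherence of `U ↦ Γ(B(U))`, Włodarczyk, arXiv:2203.03090, App. Def. 5.1.1, the relative
spectrum `B = Spec_X(R[t⁻¹])`).

Proof: the three conditions of `IsLocalization.Away.mk`. (1) `h ↦ C (h/1)` is a unit.
(2) Every element of `A'[t⁻¹, I'ₙ tⁿ]` becomes an image after multiplication by a power of `h`:
induction over `Algebra.adjoin` (generators `t⁻¹ = ψ t⁻¹`, `a' tⁿ` with `a' ∈ Iₙ A'`, so
`a' hᵏ = a/1` with `a ∈ Iₙ` by `IsLocalization.mem_map_algebraMap_iff`; constants by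
`IsLocalization.surj`; sums and products by adding exponents). (3) If `ψ x = ψ y` then
coefficientwise `xₘ/1 = yₘ/1`, so a common power `hᴷ` kills all the finitely many differences
(`IsLocalization.exists_of_eq`), whence `C(hᴷ) x = C(hᴷ) y` — this part is adapted from the tree
proof `IdealFiltration.isLocalization_away_extendedRees` (`CobordantBlowupFiltration.lean`), the
same statement for coefficientwise-defined extended Rees algebras of filtrations.

Statement spelling: the conclusion "`extReesAlgebra I'` is, via `ψ.toAlgebra`, the localisation
away from `h`" is written `@IsLocalization.Away (extReesAlgebra I) _ (algebraMap A _ h)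
(extReesAlgebra I') _ ψ.toAlgebra`; this is the term that `letI := ψ.toAlgebra;
IsLocalization.Away (algebraMap A (extReesAlgebra I) h) (extReesAlgebra I')` elaborates to (`letI`
inlines its value), see the closing `example`.
-/

set_option linter.dupNamespace false -- mandated namespace of this single-conjunct summit

namespace Summit.ResolutionOfSingularities.ResolutionOfSingularities.Theorems

open CategoryTheory AlgebraicGeometry TopologicalSpace Literature.AlgebraicGeometry.Resolution
open scoped LaurentPolynomial
open LaurentPolynomial

section Helpers

variable {A A' : Type*} [CommRing A] [CommRing A'] [Algebra A A']

/-- Base change of Laurent polynomials fixes the monomials `tⁿ`. [folklore] -/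
theorem extReesLoc_mapRingHom_T (n : ℤ) :
    AddMonoidAlgebra.mapRingHom ℤ (algebraMap A A') (T n) = T n := by
  rw [T, AddMonoidAlgebra.mapRingHom_single, map_one, T]

/-- Base change of Laurent polynomials on constants. [folklore] -/
theorem extReesLoc_mapRingHom_C (x : A) :
    AddMonoidAlgebra.mapRingHom ℤ (algebraMap A A') (C x) = C (algebraMap A A' x) := by
  rw [← single_eq_C, AddMonoidAlgebra.mapRingHom_single, single_eq_C]

/-- Base change of Laurent polynomials `A[t, t⁻¹] → A'[t, t⁻¹]` maps `A[t⁻¹, Iₙ tⁿ]` into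
`A'[t⁻¹, I'ₙ tⁿ]` as soon as `Iₙ A' ⊆ I'ₙ` (generators go to generators). [folklore] -/
theorem extReesLoc_mapRingHom_mem (I : ℕ → Ideal A) (I' : ℕ → Ideal A')
    (hle : ∀ n, (I n).map (algebraMap A A') ≤ I' n) {p : A[T;T⁻¹]}
    (hp : p ∈ extReesAlgebra I) :
    AddMonoidAlgebra.mapRingHom ℤ (algebraMap A A') p ∈ extReesAlgebra I' := by
  induction hp using Algebra.adjoin_induction with
  | mem x hx =>
    rcases hx with rfl | ⟨n, hn, a, ha, rfl⟩
    · rw [extReesLoc_mapRingHom_T]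
      exact Algebra.subset_adjoin (Set.mem_insert _ _)
    · rw [map_mul, extReesLoc_mapRingHom_C, extReesLoc_mapRingHom_T]
      exact extReesAlgebra.C_mul_T_mem I' hn (hle n (Ideal.mem_map_of_mem _ ha))
  | algebraMap r =>
    rw [← C_eq_algebraMap, extReesLoc_mapRingHom_C, C_eq_algebraMap]
    exact Subalgebra.algebraMap_mem _ _
  | add x y _ _ hx hy =>
    rw [map_add]
    exact Subalgebra.add_mem _ hx hy
  | mul x y _ _ hx hy =>
    rw [map_mul]
    exact Subalgebra.mul_mem _ hx hy

variable (h : A) [IsLocalization.Away h A']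

/-- Over `A' = A[1/h]` with `I'ₙ = Iₙ A'`: every element of `A'[t⁻¹, I'ₙ tⁿ]` becomes, after
multiplication by `C (hᴺ/1)`, the base change of an element of `A[t⁻¹, Iₙ tⁿ]`. [folklore] -/
theorem extReesLoc_exists_preimage (I : ℕ → Ideal A) (I' : ℕ → Ideal A')
    (heq : ∀ n, I' n = (I n).map (algebraMap A A')) {q : A'[T;T⁻¹]}
    (hq : q ∈ extReesAlgebra I') :
    ∃ (N : ℕ) (a : A[T;T⁻¹]), a ∈ extReesAlgebra I ∧
      q * C (algebraMap A A' (h ^ N)) = AddMonoidAlgebra.mapRingHom ℤ (algebraMap A A') a := by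
  induction hq using Algebra.adjoin_induction with
  | mem x hx =>
    rcases hx with rfl | ⟨n, hn, a', ha', rfl⟩
    · refine ⟨0, T (-1), Algebra.subset_adjoin (Set.mem_insert _ _), ?_⟩
      rw [pow_zero, map_one, map_one, mul_one, extReesLoc_mapRingHom_T]
    · rw [heq n] at ha'
      obtain ⟨⟨⟨a, ha⟩, ⟨_, k, rfl⟩⟩, e⟩ :=
        (IsLocalization.mem_map_algebraMap_iff (Submonoid.powers h) A').mp ha'
      have e' : a' * algebraMap A A' (h ^ k) = algebraMap A A' a := e
      refine ⟨k, C a * T (n : ℤ), extReesAlgebra.C_mul_T_mem I hn ha, ?_⟩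
      rw [map_mul, extReesLoc_mapRingHom_C, extReesLoc_mapRingHom_T, ← e', map_mul]
      ring
  | algebraMap r =>
    obtain ⟨⟨a, ⟨_, k, rfl⟩⟩, e⟩ := IsLocalization.surj (Submonoid.powers h) r
    have e' : r * algebraMap A A' (h ^ k) = algebraMap A A' a := e
    refine ⟨k, C a, ?_, ?_⟩
    · rw [C_eq_algebraMap]
      exact Subalgebra.algebraMap_mem _ _
    · rw [extReesLoc_mapRingHom_C, ← e', map_mul, ← C_eq_algebraMap]
  | add x y _ _ hx hy =>
    obtain ⟨N₁, a₁, ha₁, e₁⟩ := hx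
    obtain ⟨N₂, a₂, ha₂, e₂⟩ := hy
    refine ⟨N₁ + N₂, a₁ * C (h ^ N₂) + a₂ * C (h ^ N₁), ?_, ?_⟩
    · refine Subalgebra.add_mem _ (Subalgebra.mul_mem _ ha₁ ?_) (Subalgebra.mul_mem _ ha₂ ?_) <;>
        · rw [C_eq_algebraMap]; exact Subalgebra.algebraMap_mem _ _
    · rw [map_add, map_mul, map_mul, ← e₁, ← e₂, extReesLoc_mapRingHom_C, extReesLoc_mapRingHom_C,
        pow_add, map_mul, map_mul, map_pow, map_pow, map_pow, map_pow]
      ring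
  | mul x y _ _ hx hy =>
    obtain ⟨N₁, a₁, ha₁, e₁⟩ := hx
    obtain ⟨N₂, a₂, ha₂, e₂⟩ := hy
    refine ⟨N₁ + N₂, a₁ * a₂, Subalgebra.mul_mem _ ha₁ ha₂, ?_⟩
    rw [map_mul, ← e₁, ← e₂, pow_add, map_mul, map_mul]
    ring

/-- Over `A' = A[1/h]`: if two Laurent polynomials over `A` have the same base change to `A'`, a
common power `C (hᴷ)` equalises them (finitely many coefficients to kill;
`IsLocalization.exists_of_eq`). Adapted from the third part of
`IdealFiltration.isLocalization_away_extendedRees`. [folklore] -/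
theorem extReesLoc_exists_C_pow_mul_eq {p q : A[T;T⁻¹]}
    (hpq : AddMonoidAlgebra.mapRingHom ℤ (algebraMap A A') p =
      AddMonoidAlgebra.mapRingHom ℤ (algebraMap A A') q) :
    ∃ K : ℕ, C (h ^ K) * p = C (h ^ K) * q := by
  have hcoeff : ∀ m, algebraMap A A' (p.coeff m) = algebraMap A A' (q.coeff m) := by
    intro m
    have := congrArg (fun r : A'[T;T⁻¹] => r.coeff m) hpq
    simpa only [AddMonoidAlgebra.coeff_mapRingHom] using this
  -- a common power of `h` killing all the (finitely many) differences of coefficients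
  have key : ∀ s : Finset ℤ, ∃ K : ℕ, ∀ m ∈ s, h ^ K * p.coeff m = h ^ K * q.coeff m := by
    classical
    intro s
    induction s using Finset.induction_on with
    | empty => exact ⟨0, fun m hm => absurd hm (Finset.notMem_empty m)⟩
    | insert m s hm ih =>
      obtain ⟨K₁, hK₁⟩ := ih
      obtain ⟨⟨_, K₂, rfl⟩, hK₂⟩ := IsLocalization.exists_of_eq (M := Submonoid.powers h) (hcoeff m)
      change h ^ K₂ * p.coeff m = h ^ K₂ * q.coeff m at hK₂
      refine ⟨K₁ + K₂, fun m' hm' => ?_⟩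
      rcases Finset.mem_insert.mp hm' with rfl | hm'
      · rw [pow_add, mul_assoc, mul_assoc, hK₂]
      · rw [pow_add, mul_comm (h ^ K₁) (h ^ K₂), mul_assoc, mul_assoc, hK₁ m' hm']
  obtain ⟨K, hK⟩ := key (p.coeff.support ∪ q.coeff.support)
  refine ⟨K, ?_⟩
  apply LaurentPolynomial.ext
  intro m
  rw [← single_eq_C, AddMonoidAlgebra.coeff_single_zero_mul, AddMonoidAlgebra.coeff_single_zero_mul]
  by_cases hm : m ∈ p.coeff.support ∪ q.coeff.support
  · exact hK m hm
  · rw [Finset.mem_union, not_or, Finsupp.notMem_support_iff, Finsupp.notMem_support_iff] at hm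
    rw [hm.1, hm.2]

end Helpers

/-- **Extended Rees algebras localise** (quasi-coherence of `U ↦ Γ(B(U))` for the full cobordant
blow-up `B = Spec_X(R[t⁻¹])`, Włodarczyk App. Def. 5.1.1). If `A' = A[1/h]` and `I'ₙ = Iₙ A'`
for all `n`, then the base change of Laurent polynomials restricts to a ring map
`ψ : A[t⁻¹, Iₙ tⁿ] → A'[t⁻¹, I'ₙ tⁿ]` which is the localisation away from `h`. Compare
`IdealFiltration.isLocalization_away_extendedRees` (the same statement for the coefficientwise
extended Rees algebra of an antitone multiplicative filtration).
[cite: Wlodarczyk2022, Def. 5.1.1] -/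
theorem stub_extReesAlgebra_localization :
    ∀ {A A' : Type} [CommRing A] [CommRing A'] [Algebra A A'] (h : A) [IsLocalization.Away h A']
      (I : ℕ → Ideal A) (I' : ℕ → Ideal A'), (∀ n, I' n = (I n).map (algebraMap A A')) →
      ∃ ψ : extReesAlgebra I →+* extReesAlgebra I',
        (∀ x : extReesAlgebra I, ((ψ x : extReesAlgebra I') : A'[T;T⁻¹]) =
            AddMonoidAlgebra.mapRingHom ℤ (algebraMap A A') (x : A[T;T⁻¹])) ∧
        @IsLocalization.Away (extReesAlgebra I) _ (algebraMap A (extReesAlgebra I) h)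
          (extReesAlgebra I') _ ψ.toAlgebra := by
  intro A A' _ _ _ h _ I I' heq
  have hle : ∀ n, (I n).map (algebraMap A A') ≤ I' n := fun n => (heq n).ge
  set φ := algebraMap A A' with hφ
  let ψ : extReesAlgebra I →+* extReesAlgebra I' :=
    (AddMonoidAlgebra.mapRingHom ℤ φ).restrict (extReesAlgebra I) (extReesAlgebra I')
      fun _ hp => extReesLoc_mapRingHom_mem I I' hle hp
  have hψ : ∀ x : extReesAlgebra I, ((ψ x : extReesAlgebra I') : A'[T;T⁻¹]) =
      AddMonoidAlgebra.mapRingHom ℤ φ (x : A[T;T⁻¹]) := fun _ => rfl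
  refine ⟨ψ, hψ, ?_⟩
  letI := ψ.toAlgebra
  have halg : ∀ p : extReesAlgebra I, algebraMap (extReesAlgebra I) (extReesAlgebra I') p = ψ p :=
    fun _ => rfl
  -- the image of `(C h)ᵏ` is `C (hᵏ/1)`
  have hCf : ∀ k : ℕ, (((algebraMap (extReesAlgebra I) (extReesAlgebra I')
      (algebraMap A (extReesAlgebra I) h)) ^ k : extReesAlgebra I') : A'[T;T⁻¹]) =
        C (φ (h ^ k)) := by
    intro k
    rw [SubmonoidClass.coe_pow, halg, hψ, Subalgebra.coe_algebraMap, ← C_eq_algebraMap,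
      extReesLoc_mapRingHom_C, ← map_pow, ← map_pow]
  refine IsLocalization.Away.mk _ ?_ ?_ ?_
  · -- `h` becomes a unit
    have hu : IsUnit (algebraMap A' (extReesAlgebra I') (φ h)) :=
      (IsLocalization.Away.algebraMap_isUnit h).map _
    convert hu using 1
    apply Subtype.ext
    have h1 := hCf 1
    rw [pow_one, pow_one] at h1
    rw [h1, Subalgebra.coe_algebraMap, C_eq_algebraMap]
  · -- every element of `A'[t⁻¹, I'ₙ tⁿ]` is a fraction
    intro z
    obtain ⟨N, a, ha, e⟩ := extReesLoc_exists_preimage h I I' heq z.2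
    refine ⟨N, ⟨a, ha⟩, Subtype.ext ?_⟩
    rw [MulMemClass.coe_mul, hCf N, halg, hψ]
    exact e
  · -- the kernel is `h`-torsion
    intro p q hpq
    have hpq' : AddMonoidAlgebra.mapRingHom ℤ φ (p : A[T;T⁻¹]) =
        AddMonoidAlgebra.mapRingHom ℤ φ (q : A[T;T⁻¹]) := by
      rw [← hψ, ← hψ, ← halg, ← halg, hpq]
    obtain ⟨K, hK⟩ := extReesLoc_exists_C_pow_mul_eq h hpq'
    refine ⟨K, Subtype.ext ?_⟩
    rw [MulMemClass.coe_mul, MulMemClass.coe_mul, SubmonoidClass.coe_pow, Subalgebra.coe_algebraMap,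
      ← C_eq_algebraMap, ← map_pow]
    exact hK

/-- Sanity check (statement shape): the `@IsLocalization.Away … ψ.toAlgebra` conclusion above is
the very proposition written with `letI := ψ.toAlgebra` in the line skeleton (Lean's `letI`
inlines its value, so the two spellings elaborate to the same term; this `example` is closed by
the stub itself). [folklore] -/
example :
    ∀ {A A' : Type} [CommRing A] [CommRing A'] [Algebra A A'] (h : A) [IsLocalization.Away h A']
      (I : ℕ → Ideal A) (I' : ℕ → Ideal A'), (∀ n, I' n = (I n).map (algebraMap A A')) →
      ∃ ψ : extReesAlgebra I →+* extReesAlgebra I',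
        (∀ x : extReesAlgebra I, ((ψ x : extReesAlgebra I') : A'[T;T⁻¹]) =
            AddMonoidAlgebra.mapRingHom ℤ (algebraMap A A') (x : A[T;T⁻¹])) ∧
        (letI := ψ.toAlgebra
         IsLocalization.Away (algebraMap A (extReesAlgebra I) h) (extReesAlgebra I')) :=
  stub_extReesAlgebra_localization

end Summit.ResolutionOfSingularities.ResolutionOfSingularities.Theorems
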